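import Summits.RiemannHypothesis.RiemannHypothesis.Theses.SpectralTrace
import Summits.RiemannHypothesis.RiemannHypothesis.Theorems.SpectralTraceSpectralThesisClosedLadderCells
import Summits.RiemannHypothesis.RiemannHypothesis.Theorems.WindowTraceArch.Negative.LocalWeyl
import Summits.RiemannHypothesis.RiemannHypothesis.Theorems.WindowTraceArch.Negative.LocalWeylTools
import Summits.RiemannHypothesis.RiemannHypothesis.Theorems.WindowTraceArch.Negative.UnitMass
import Literature.NumberTheory.LFunctions.WeilMellinBounds
import HarnessLib

/-!
# Crux `SpectralThesis` (stmt-RiemannHypothesis-0187), line `Sketch` — stub `stub_closedLadder`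

CLOSEDNESS of the open-window rungs: if every smaller open window `(-A', A')`, `A' < A`, carries a
real family reproducing the Weil functional on the Weil tests supported there, then so does the
open window `(-A, A)`.

Proof (cell-wise ultrafilter limit, no arithmetic and no measure theory). Take witnesses `γ_k`
for windows `a_k ↑ A`; all of them are closed-window families for the fixed window `[-A/4, A/4]`,
so by the uniform local Weyl bound (`exists_uniform_card_near_le_log`) the number of points of
`γ_k` in the cell `(n, n+1]` is `≤ C (2 + |n|)` uniformly in `k`. Along the free ultrafilter
`hyperfilter ℕ` the cell counts stabilise (`s n`) and the enumerated cells converge in the compact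
cubes `[n, n+1]^{s n}` (`IsCompact.ultrafilter_le_nhds`) to limit blocks `w n`. The limit family
is `Σ n, Fin (s n)`, `⟨n, j⟩ ↦ w n j`. For a test `g` supported in the open window, the identity
`Σ_i ĝ(1/2 + iγ_{k,i}) = W(g)` holds for all large `k`; regrouped along the cells
(`hasSum_fiber`) it passes to the limit by Tannery's theorem
(`tendsto_tsum_of_dominated_convergence`, domination `C (2+|n|) · 16 D_g / (1+n²)²` from
`norm_weilMellin_cell_le`), and the absolutely convergent limit series is re-read on the sigma
type (`HasSum.sigma_of_hasSum`).
-/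

noncomputable section

set_option linter.dupNamespace false

open Complex Set Filter
open scoped Topology

namespace Summit.RiemannHypothesis.RiemannHypothesis.Theorems.SpectralThesis.Sketch

open Literature.NumberTheory.LFunctions
open Summit.RiemannHypothesis.RiemannHypothesis.Theorems.SpectralThesis.Sketch.ClosedLadder

namespace ClosedLadder

/-- **The analytic half of the cell-wise limit.** Given families `γ_k` chopped into finite cells
`{i : cls k i = n} ⊆ (n, n+1]` with `≤ C (2 + |n|)` points, limit blocks `w n : Fin (s n) → [n, n+1]`
with `s n ≤ C (2 + |n|)`, a Weil test `g` whose cell sums converge along the filter `U` to the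
block sums, and the identity `Σ_i ĝ(1/2 + iγ_{k,i}) = a` for `U`-many `k`: the limit family
`⟨n, j⟩ ↦ w n j` satisfies `HasSum (p ↦ ĝ(1/2 + i w_p)) a` (Tannery's theorem along `U` with the
domination `C (2 + |n|) · 16 D_g / (1 + n²)²`, then absolute convergence on the sigma type).
[folklore] -/
theorem hasSum_limit_family {U : Filter ℕ} [NeBot U] {ι : ℕ → Type} (γ : ∀ k, ι k → ℝ)
    (cls : ∀ k, ι k → ℤ) (hcls : ∀ k i, γ k i ∈ Ioc ((cls k i : ℝ)) ((cls k i : ℝ) + 1))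
    (hfin : ∀ k n, Finite {i // cls k i = n}) {C : ℝ}
    (hcard : ∀ k n, (Nat.card {i // cls k i = n} : ℝ) ≤ C * (2 + |(n : ℝ)|))
    (s : ℤ → ℕ) (hsC : ∀ n, (s n : ℝ) ≤ C * (2 + |(n : ℝ)|))
    (w : ∀ n, Fin (s n) → ℝ) (hw : ∀ (n : ℤ) (j : Fin (s n)), w n j ∈ Icc (n : ℝ) (n + 1))
    {g : ℝ → ℂ} (hg : IsWeilTest g)
    (htend : ∀ n : ℤ, Tendsto
      (fun k => ∑' i : {i // cls k i = n}, weilMellin g (1 / 2 + (γ k i.1 : ℂ) * I)) U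
      (𝓝 (∑ j, weilMellin g (1 / 2 + (w n j : ℂ) * I))))
    {a : ℂ} (hev : ∀ᶠ k in U, HasSum (fun i => weilMellin g (1 / 2 + (γ k i : ℂ) * I)) a) :
    HasSum (fun p : (Σ n : ℤ, Fin (s n)) => weilMellin g (1 / 2 + (w p.1 p.2 : ℂ) * I)) a := by
  set F : ℝ → ℂ := fun u => weilMellin g (1 / 2 + (u : ℂ) * I) with hF_def
  set D : ℝ := weilDecayConst g + weilDecayConst (deriv (deriv g)) with hD_def
  have hD0 : 0 ≤ D := add_nonneg (weilDecayConst_nonneg _) (weilDecayConst_nonneg _)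
  set φ : ℤ → ℝ := fun n => 16 * D / (1 + (n : ℝ) ^ 2) ^ 2 with hφ_def
  have hφ0 : ∀ n, 0 ≤ φ n := fun n => by positivity
  have hFφ : ∀ (n : ℤ) (u : ℝ), u ∈ Icc (n : ℝ) (n + 1) → ‖F u‖ ≤ φ n :=
    fun n u hu => norm_weilMellin_cell_le hg hu
  set b : ℤ → ℝ := fun n => C * (2 + |(n : ℝ)|) * φ n with hb_def
  have hb : Summable b := summable_cellBound C D hD0
  -- (i) uniform domination of the cell sums
  have hc_bound : ∀ k n, ‖∑' i : {i // cls k i = n}, F (γ k i.1)‖ ≤ b n := by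
    intro k n
    haveI : Finite {i // cls k i = n} := hfin k n
    haveI : Fintype {i // cls k i = n} := Fintype.ofFinite _
    rw [tsum_fintype]
    refine (norm_sum_le _ _).trans ?_
    calc ∑ i : {i // cls k i = n}, ‖F (γ k i.1)‖ ≤ ∑ _i : {i // cls k i = n}, φ n :=
          Finset.sum_le_sum fun i _ => hFφ n _ (by
            have hm := hcls k i.1
            rw [i.2] at hm
            exact Ioc_subset_Icc_self hm)
      _ = (Nat.card {i // cls k i = n} : ℝ) * φ n := by
          rw [Finset.sum_const, nsmul_eq_mul, Finset.card_univ, Nat.card_eq_fintype_card]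
      _ ≤ C * (2 + |(n : ℝ)|) * φ n := mul_le_mul_of_nonneg_right (hcard k n) (hφ0 n)
  -- (ii) for `U`-many `k` the regrouped sum is `a`
  have hc_sum : ∀ᶠ k in U, ∑' n, ∑' i : {i // cls k i = n}, F (γ k i.1) = a := by
    filter_upwards [hev] with k hk
    exact (hasSum_fiber (cls k) (hfin k) hk).tsum_eq
  -- (iii) Tannery's theorem along `U`
  have hT : Tendsto (fun k => ∑' n, ∑' i : {i // cls k i = n}, F (γ k i.1)) U
      (𝓝 (∑' n, ∑ j, F (w n j))) :=
    tendsto_tsum_of_dominated_convergence hb htend (Eventually.of_forall fun k n => hc_bound k n)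
  have hlim : ∑' n, ∑ j, F (w n j) = a :=
    tendsto_nhds_unique hT (tendsto_const_nhds.congr' (by
      filter_upwards [hc_sum] with k hk
      exact hk.symm))
  -- (iv) the limit blocks
  have hcell : ∀ n, ∑ j : Fin (s n), ‖F (w n j)‖ ≤ b n := by
    intro n
    calc ∑ j : Fin (s n), ‖F (w n j)‖ ≤ ∑ _j : Fin (s n), φ n :=
          Finset.sum_le_sum fun j _ => hFφ n _ (hw n j)
      _ = (s n : ℝ) * φ n := by
          rw [Finset.sum_const, nsmul_eq_mul, Finset.card_univ, Fintype.card_fin]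
      _ ≤ C * (2 + |(n : ℝ)|) * φ n := mul_le_mul_of_nonneg_right (hsC n) (hφ0 n)
  have hcl : HasSum (fun n => ∑ j, F (w n j)) a := by
    have hsum : Summable fun n => ∑ j, F (w n j) :=
      Summable.of_norm_bounded hb fun n => (norm_sum_le _ _).trans (hcell n)
    rw [← hlim]
    exact hsum.hasSum
  have hsumσ : Summable fun p : (Σ n : ℤ, Fin (s n)) => F (w p.1 p.2) := by
    refine Summable.of_norm ?_
    refine (summable_sigma_of_nonneg fun _ => norm_nonneg _).2 ⟨fun n => Summable.of_finite, ?_⟩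
    refine Summable.of_nonneg_of_le (fun n => tsum_nonneg fun _ => norm_nonneg _) (fun n => ?_) hb
    rw [tsum_fintype]
    exact hcell n
  exact hcl.sigma_of_hasSum (fun n => hasSum_fintype _) hsumσ

/-- **Cell-wise ultrafilter limit of window families.** Let `γ_k` (`k : ℕ`) be real families
reproducing the Weil functional on the Weil tests supported in a fixed closed window `[-B, B]`.
Then there is ONE real family `γ'` such that every identity `Σ_i ĝ(1/2 + iγ_{k,i}) = a` valid
for `hyperfilter ℕ`-many `k` (in particular, for all large `k`) passes to `γ'`:
`HasSum (i ↦ ĝ(1/2 + iγ'_i)) a`. [folklore] -/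
theorem exists_limit_family {B : ℝ} (hB : 0 < B) {ι : ℕ → Type} (γ : ∀ k, ι k → ℝ)
    (hγ : ∀ k, ∀ g : ℝ → ℂ, IsWeilTest g → tsupport g ⊆ Icc (-B) B →
      HasSum (fun i => weilMellin g (1 / 2 + (γ k i : ℂ) * I)) (weilFunctional g)) :
    ∃ (ι' : Type) (γ' : ι' → ℝ), ∀ g : ℝ → ℂ, IsWeilTest g → ∀ a : ℂ,
      (∀ᶠ k in ((hyperfilter ℕ : Ultrafilter ℕ) : Filter ℕ),
        HasSum (fun i => weilMellin g (1 / 2 + (γ k i : ℂ) * I)) a) →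
      HasSum (fun i => weilMellin g (1 / 2 + (γ' i : ℂ) * I)) a := by
  obtain ⟨C, hC, hcount⟩ := exists_uniform_card_near_le_log hB
  -- the cells `cls k i = n ↔ γ_{k,i} ∈ (n, n+1]`
  obtain ⟨cls, hcls⟩ : ∃ cls : ∀ k, ι k → ℤ,
      ∀ k i, γ k i ∈ Ioc ((cls k i : ℝ)) ((cls k i : ℝ) + 1) :=
    ⟨fun k i => ⌈γ k i⌉ - 1, fun k i => by
      push_cast
      exact ⟨by linarith [Int.ceil_lt_add_one (γ k i)], by linarith [Int.le_ceil (γ k i)]⟩⟩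
  -- finiteness and the UNIFORM bound of the cell counts
  have hκ : ∀ k (n : ℤ), Finite {i // cls k i = n} ∧
      (Nat.card {i // cls k i = n} : ℝ) ≤ C * (2 + |(n : ℝ)|) := by
    intro k n
    refine finite_and_natCard_le fun t ht => ?_
    have h1 := hcount (γ k) (hγ k) ((n : ℝ) + 1 / 2) t fun i hi => ?_
    · refine h1.trans (mul_le_mul_of_nonneg_left ?_ hC.le)
      have h2 : Real.log (1 + |(n : ℝ) + 1 / 2|) ≤ |(n : ℝ) + 1 / 2| := by
        have := Real.log_le_sub_one_of_pos (by positivity : (0 : ℝ) < 1 + |(n : ℝ) + 1 / 2|)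
        linarith
      have h3 : |(n : ℝ) + 1 / 2| ≤ |(n : ℝ)| + 1 / 2 := by
        have := abs_add_le (n : ℝ) (1 / 2)
        rwa [abs_of_pos (by norm_num : (0 : ℝ) < 1 / 2)] at this
      linarith
    · have hm := hcls k i
      rw [ht i hi] at hm
      rw [abs_le]
      constructor <;> linarith [hm.1, hm.2]
  have hfinT : ∀ k n, Finite {i // cls k i = n} := fun k n => (hκ k n).1
  set U : Ultrafilter ℕ := hyperfilter ℕ with hU_def
  -- the cell counts stabilise along `U`
  have hsExists : ∀ n : ℤ, ∃ m : ℕ, (m : ℝ) ≤ C * (2 + |(n : ℝ)|) ∧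
      ∀ᶠ k in (U : Filter ℕ), Nat.card {i // cls k i = n} = m := by
    intro n
    obtain ⟨m, -, hm⟩ := (Ultrafilter.eventually_exists_mem_iff (f := U)
      (P := fun (m : ℕ) (k : ℕ) => Nat.card {i // cls k i = n} = m)
      (Set.finite_Iic ⌈C * (2 + |(n : ℝ)|)⌉₊)).1
      (Eventually.of_forall fun k => ⟨Nat.card {i // cls k i = n}, by
        show Nat.card {i // cls k i = n} ≤ ⌈C * (2 + |(n : ℝ)|)⌉₊
        exact_mod_cast (hκ k n).2.trans (Nat.le_ceil _), rfl⟩)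
    obtain ⟨k, hk⟩ := hm.exists
    exact ⟨m, by have := (hκ k n).2; rwa [hk] at this, hm⟩
  choose s hsC hs using hsExists
  -- enumerate the cells with exactly `s n` points (junk value `n` otherwise)
  have v_def : ∀ k (n : ℤ), ∃ v : Fin (s n) → ℝ, (∀ j, v j ∈ Icc (n : ℝ) (n + 1)) ∧
      ∀ (h : Nat.card {i // cls k i = n} = s n) (j : Fin (s n)),
        v j = γ k ((@Finite.equivFinOfCardEq _ (hfinT k n) _ h).symm j).1 := by
    intro k n
    by_cases h : Nat.card {i // cls k i = n} = s n
    · refine ⟨fun j => γ k ((@Finite.equivFinOfCardEq _ (hfinT k n) _ h).symm j).1,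
        fun j => ?_, fun _ _ => rfl⟩
      have hm := hcls k ((@Finite.equivFinOfCardEq _ (hfinT k n) _ h).symm j).1
      rw [((@Finite.equivFinOfCardEq _ (hfinT k n) _ h).symm j).2] at hm
      exact Ioc_subset_Icc_self hm
    · exact ⟨fun _ => n, fun _ => ⟨le_rfl, by linarith⟩, fun h' => absurd h' h⟩
  choose v hv_mem hv_eq using v_def
  -- limit blocks in the compact cubes `[n, n+1]^{s n}`
  have w_def : ∀ n : ℤ, ∃ w : Fin (s n) → ℝ, (∀ j, w j ∈ Icc (n : ℝ) (n + 1)) ∧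
      Tendsto (fun k => v k n) (U : Filter ℕ) (𝓝 w) := by
    intro n
    have hK : IsCompact (Set.pi Set.univ fun _ : Fin (s n) => Icc (n : ℝ) (n + 1)) :=
      isCompact_univ_pi fun _ => isCompact_Icc
    obtain ⟨w, hwK, hle⟩ := hK.ultrafilter_le_nhds (Ultrafilter.map (fun k => v k n) U) (by
      rw [Ultrafilter.coe_map, Filter.le_principal_iff, Filter.mem_map]
      exact Filter.univ_mem' fun k => Set.mem_univ_pi.2 fun j => hv_mem k n j)
    rw [Ultrafilter.coe_map] at hle
    exact ⟨w, fun j => Set.mem_univ_pi.1 hwK j, hle⟩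
  choose w hw_mem hw_tend using w_def
  -- the limit family
  refine ⟨(Σ n : ℤ, Fin (s n)), fun p => w p.1 p.2, fun g hg a hev => ?_⟩
  refine hasSum_limit_family γ cls hcls hfinT (fun k n => (hκ k n).2) s hsC w hw_mem hg
    (fun n => ?_) hev
  -- convergence of the cell sums: continuity of `ĝ` on the cube, and the enumeration
  have hFc : Continuous fun u : ℝ => weilMellin g (1 / 2 + (u : ℂ) * I) :=
    (continuous_weilMellin hg.1.continuous hg.2).comp (by fun_prop)
  have hΦ : Continuous fun x : Fin (s n) → ℝ => ∑ j, weilMellin g (1 / 2 + (x j : ℂ) * I) :=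
    continuous_finsetSum _ fun j _ => hFc.comp (continuous_apply j)
  refine ((hΦ.tendsto (w n)).comp (hw_tend n)).congr' ?_
  filter_upwards [hs n] with k hk
  haveI : Finite {i // cls k i = n} := hfinT k n
  have h2 : ∑' i : {i // cls k i = n}, weilMellin g (1 / 2 + (γ k i.1 : ℂ) * I) =
      ∑' j : Fin (s n), weilMellin g
        (1 / 2 + (γ k ((@Finite.equivFinOfCardEq _ (hfinT k n) _ hk).symm j).1 : ℂ) * I) :=
    (Equiv.tsum_eq (@Finite.equivFinOfCardEq _ (hfinT k n) _ hk).symm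
      (fun i : {i // cls k i = n} => weilMellin g (1 / 2 + (γ k i.1 : ℂ) * I))).symm
  rw [Function.comp_apply, h2, tsum_fintype]
  exact Finset.sum_congr rfl fun j _ => by rw [hv_eq k n hk j]

end ClosedLadder

/-- **STUB · `stub_closedLadder`** (closedness of the open-window rungs). If every smaller open
window `(-A', A')`, `0 < A' < A`, carries a real family reproducing the Weil functional on the Weil
tests supported there, then so does `(-A, A)`: the cell-wise ultrafilter limit
(`exists_limit_family`) of witnesses for `a_k ↑ A`, all of them closed-window families on
`[-A/4, A/4]`; a test supported in the open window has compact support inside some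
`[-A'', A''] ⊆ (-a_k, a_k)` for all large `k`. [folklore] -/
theorem stub_closedLadder :
    ∀ A : ℝ, 0 < A →
      (∀ A' : ℝ, 0 < A' → A' < A → ∃ (ι : Type) (γ : ι → ℝ), ∀ g : ℝ → ℂ, IsWeilTest g →
        tsupport g ⊆ Set.Ioo (-A') A' →
          HasSum (fun i => weilMellin g (1 / 2 + (γ i : ℂ) * I)) (weilFunctional g)) →
      ∃ (ι : Type) (γ : ι → ℝ), ∀ g : ℝ → ℂ, IsWeilTest g → tsupport g ⊆ Set.Ioo (-A) A →
        HasSum (fun i => weilMellin g (1 / 2 + (γ i : ℂ) * I)) (weilFunctional g) := by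
  intro A hA H
  -- exhausting windows `a k ↑ A` with `A/2 ≤ a k < A`
  obtain ⟨a, ha, hat⟩ : ∃ a : ℕ → ℝ, (∀ k, A / 2 ≤ a k ∧ a k < A) ∧ Tendsto a atTop (𝓝 A) := by
    refine ⟨fun k => A * (1 - 1 / ((k : ℝ) + 1) / 2), fun k => ?_, ?_⟩
    · have h1 : 0 < 1 / ((k : ℝ) + 1) := by positivity
      have h2 : 1 / ((k : ℝ) + 1) ≤ 1 := by
        rw [div_le_one (by positivity)]
        linarith [(Nat.cast_nonneg k : (0 : ℝ) ≤ k)]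
      constructor <;> nlinarith
    · have h0 : Tendsto (fun k : ℕ => 1 / ((k : ℝ) + 1)) atTop (𝓝 0) :=
        tendsto_one_div_add_atTop_nhds_zero_nat
      have := ((h0.div_const 2).const_sub 1).const_mul A
      simpa using this
  choose ι γ hγ using fun k : ℕ => H (a k) (by linarith [(ha k).1]) (ha k).2
  -- all of them are closed-window families on `[-A/4, A/4]`
  have hB : 0 < A / 4 := by positivity
  have hγB : ∀ k, ∀ g : ℝ → ℂ, IsWeilTest g → tsupport g ⊆ Icc (-(A / 4)) (A / 4) →
      HasSum (fun i => weilMellin g (1 / 2 + (γ k i : ℂ) * I)) (weilFunctional g) :=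
    fun k g hg hgs => hγ k g hg (hgs.trans
      (Icc_subset_Ioo (by linarith [(ha k).1]) (by linarith [(ha k).1])))
  obtain ⟨ι', γ', hlim⟩ := ClosedLadder.exists_limit_family hB γ hγB
  refine ⟨ι', γ', fun g hg hgs => hlim g hg _ ?_⟩
  -- the compact support sits inside a closed sub-window `[-A'', A'']`, `A'' < A`
  obtain ⟨A'', hA''A, hsub⟩ : ∃ A'' < A, tsupport g ⊆ Icc (-A'') A'' := by
    rcases (tsupport g).eq_empty_or_nonempty with he | hne
    · exact ⟨0, hA, by rw [he]; exact empty_subset _⟩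
    · obtain ⟨x₀, hx₀, hmax⟩ := hg.2.isCompact.exists_isMaxOn hne continuous_abs.continuousOn
      refine ⟨|x₀|, ?_, fun x hx => ?_⟩
      · have h := hgs hx₀
        exact abs_lt.2 ⟨h.1, h.2⟩
      · have h : |x| ≤ |x₀| := hmax hx
        exact ⟨by linarith [neg_abs_le x], by linarith [le_abs_self x]⟩
  -- hence inside `(-a k, a k)` for all large `k`, a `hyperfilter`-large set of `k`
  have hevA : ∀ᶠ k in atTop, A'' < a k := hat.eventually_const_lt hA''A
  refine (hevA.mono fun k hk => ?_).filter_mono Nat.hyperfilter_le_atTop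
  exact hγ k g hg (hsub.trans (Icc_subset_Ioo (by linarith) hk))

end Summit.RiemannHypothesis.RiemannHypothesis.Theorems.SpectralThesis.Sketch

end
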